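import Summits.QuantumFields.BalabanUV.Beta.FP.ExpLocalisedBubbleMixedPieces

/-!
# `BalabanUV.Beta.FP.ExpLocalisedBubbleMixed` — road «FP», N7 H-route, row H2-ASM-1 proper, part B (the assembly): THE DOUBLE (BUBBLE) SMEAR OF TWO ZERO-MASS
# EXPONENTIALLY LOCALISED TWO-POINT WEIGHTS AGAINST TWO GRADED LEGS = THE FOUR PLACEMENTS OF TWO LATTICE DERIVATIVES + `O((‖z‖∞+1)^{−(a+b+3)})`
# ([folklore] lattice power counting; nothing of the manuscripts)

HONEST DEPENDENCY (page 1, mandatory): continuum YM on T⁴ ⇐ BetaPertH ∧ nine spine estimates (0/9 proved); BetaPertH ⇐ (D1) ∧ (D4) ∧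
CAP+tail; G-an2-4 gates asym, D1 and NE2/3/4.  HONEST FRAMING (cell contract, verbatim): «discharging `BetaPertH` makes Bałaban's UV
stability UNCONDITIONAL — a real constructive-QFT result; it is NOT the continuum limit and NOT the Clay problem.»  THIS MODULE is elementary [folklore] real
analysis on `ℤ⁴`, assembled BY NAME from `FP/ExpLocalisedBubbleMixedPieces` (T1, T2a, T2b, inner, Fubini, T3) and the engine `FP/ExpLocalisedBubble{,Point,Product,Order2,
Order2Point,Marginals}` (this lineage, g6–g8).  Every analytic input (localisation of `c₀, c₁`, their ZERO TOTAL MASS, the decay of `F, G` and of their differences to order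
three) is a HYPOTHESIS displayed in the signatures; no `def` (the constant `KR` is WRITTEN OUT in the statement), no `Prop` fact, nothing cited, 0 sorry.  NOT the bubble of the perfect theory (fibre∕colour sums, `Pker`, admissible vertices = H2-ASM-2∕3), NOT the tadpole, NOT `hgerm`, NOT `hasym`, NOT D1,
NOT BetaPertH, NOT continuum, NOT Clay.

ROW (road FP owner d1-p3-g6, `H2V-DESIGN.md` f78878bd5f8d2d18 §4 H2-ASM-1, R-FP-23 (c) first refusal of this lineage; CLAIM journal l.23466, silence-GO 23:55Z).

THE OBJECT (written out, no def): `B z := Σ'_{P : (Pt×Pt)×(Pt×Pt)} c₀ P.1 · c₁ P.2 · F (z + P.2.1 − P.1.1) · G (z + P.2.2 − P.1.2)` — `P.1 = (x,x′)` the two legs at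
vertex 0, `P.2 = (y,y′)` the two legs at the vertex at `z` (recentred to 0); component `.1` on line `F`, `.2` on line `G`.  MOMENTS `m_j¹_κ := Σ' c_j p·(p.1)_κ`,
`m_j²_κ := Σ' c_j p·(p.2)_κ`.  LEADING TERM
`Lead z := −Σ_{i,j} [ m₀¹_i m₁¹_j·(G z·Δ_iΔ_jF z) + m₀¹_i m₁²_j·(Δ_iF z·Δ_jG z) + m₀²_i m₁¹_j·(Δ_jF z·Δ_iG z) + m₀²_i m₁²_j·(F z·Δ_iΔ_jG z) ]`
(RULE: the moment of vertex `j` in leg `ℓ`, direction `κ`, puts `Δ_κ` on LINE `ℓ` — both derivatives on one line when both moments sit on that line's legs (the `legW`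
placements `ℓ₀·∂∂ℓ₀`), one on each line otherwise (the `legWx` placement `∂ℓ₀·∂ℓ₀`); sign `−` from `s = y − x`; all terms of total degree < 2 vanish by the zero masses).

CONTENT: §1 algebra (`pointwise_split`, `assemble_sub`, `abs_assemble_le`, `lead_eq`); §2 **`abs_bubble_sub_lead_le`** — for EVERY `z`,
`|B z − Lead z| ≤ KR/(‖z‖∞+1)^{a+b+3}`, `KR := C₀C₁·[A₀·Zl²·K₂(G) + 8A₁·Zl·Zm₁·K₁(G) + B₀·Zl²·K₂(F) + K₁(F)·K₀(G)]` (`Zl = Zl 4 δ`, `Zm₁ = Zm δ 1`, `K₀,K₁,K₂` the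
named point constants of `FP/ExpLocalisedBubbleOrder2Point`).  PROOF = the owner's iteration made exact: `B = Σ'_r S_r·G_r` (lines), `S_r = u₁u₀·F z + Σ_κ(ν₁κu₀ − u₁ν₀κ)·Δ_κF z
+ E_r` with `|E_r| ≤ (C₀C₁K₁(F)/(n+1)^{a+2})·e^{−δ(|r.1|₁+|r.2|₁)}` (inner, order one), the three explicit r-smears by T1∕T2a∕T2b, `Σ' E_r G_r = (Σ'E)·G z + O` (order zero with the
WEIGHT `E`), `Σ'E = Σ'S` (zero masses) `= −ΣΣ m₀¹m₁¹ΔΔF + O` (Fubini + T3).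
Unit `b2b-balaban-beta-d1-formalise-leaf-02` (gen 8).
-/

noncomputable section

namespace Summit.QuantumFields.BalabanUV.Beta.FP.ExpLocalisedBubbleMixed

open Finset Filter Topology fwdDiff
open scoped BigOperators
open Literature.MathematicalPhysics.QuantumFieldTheory.Balaban1983to89
open Literature.MathematicalPhysics.QuantumFieldTheory.Balaban1983to89.Beta
open B12Sec2to5 (l1 l1_nonneg abs_coord_le_l1)
open ExpKernelCalculus (Site Zl Zl_pos)
open Summit.QuantumFields.BalabanUV.Beta.FP.ExpLocalisedBubble
open Summit.QuantumFields.BalabanUV.Beta.FP.ExpLocalisedBubblePoint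
open Summit.QuantumFields.BalabanUV.Beta.FP.ExpLocalisedBubbleProduct
open Summit.QuantumFields.BalabanUV.Beta.FP.ExpLocalisedBubbleOrder2
open Summit.QuantumFields.BalabanUV.Beta.FP.ExpLocalisedBubbleOrder2Point
open Summit.QuantumFields.BalabanUV.Beta.FP.ExpLocalisedBubbleMarginals
open Summit.QuantumFields.BalabanUV.Beta.FP.ExpLocalisedBubbleMixedPieces
open DyadicShell (Pt supNorm supNorm_eq_zero_iff)

/-! ## §1 Finite algebra of the assembly -/

/-- [folklore] Pointwise split of `S·G` into the three explicit pieces and the remainder piece. -/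
theorem pointwise_split (S W G Fz : ℝ) (Wa Wb dF : Fin 4 → ℝ) :
    S * G = Fz * (W * G) + ∑ κ, dF κ * (Wa κ * G - Wb κ * G) + (S - W * Fz - ∑ κ, (Wa κ - Wb κ) * dF κ) * G := by
  have : ∑ κ, dF κ * (Wa κ * G - Wb κ * G) = (∑ κ, (Wa κ - Wb κ) * dF κ) * G := by
    rw [Finset.sum_mul]; exact Finset.sum_congr rfl fun κ _ => by ring
  rw [this]; ring

/-- [folklore] Regrouping `B − Lead` piece by piece. -/
theorem assemble_sub (Fz Gz X₁ L4 XE SE L1 : ℝ) (dF X₂ X₃ L2 L3 : Fin 4 → ℝ) :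
    (Fz * X₁ + ∑ κ, dF κ * (X₂ κ - X₃ κ) + XE) - (Fz * L4 + ∑ κ, dF κ * (L2 κ - L3 κ) + Gz * L1)
      = Fz * (X₁ - L4) + ∑ κ, dF κ * ((X₂ κ - L2 κ) - (X₃ κ - L3 κ)) + ((XE - SE * Gz) + Gz * (SE - L1)) := by
  have : ∑ κ, dF κ * ((X₂ κ - L2 κ) - (X₃ κ - L3 κ)) = ∑ κ, dF κ * (X₂ κ - X₃ κ) - ∑ κ, dF κ * (L2 κ - L3 κ) := by
    rw [← Finset.sum_sub_distrib]; exact Finset.sum_congr rfl fun κ _ => by ring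
  rw [this]; ring

/-- [folklore] Triangle inequality for the regrouped difference. -/
theorem abs_assemble_le (Fz Gz X₁ L4 XE SE L1 : ℝ) (dF X₂ X₃ L2 L3 : Fin 4 → ℝ) :
    |Fz * (X₁ - L4) + ∑ κ, dF κ * ((X₂ κ - L2 κ) - (X₃ κ - L3 κ)) + ((XE - SE * Gz) + Gz * (SE - L1))|
      ≤ |Fz| * |X₁ - L4| + ∑ κ, |dF κ| * (|X₂ κ - L2 κ| + |X₃ κ - L3 κ|) + (|XE - SE * Gz| + |Gz| * |SE - L1|) := by
  refine (abs_add_le _ _).trans (add_le_add ((abs_add_le _ _).trans (add_le_add (le_of_eq (abs_mul _ _)) ?_))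
    ((abs_add_le _ _).trans (add_le_add le_rfl (le_of_eq (abs_mul _ _)))))
  refine (Finset.abs_sum_le_sum_abs _ _).trans (Finset.sum_le_sum fun κ _ => ?_)
  rw [abs_mul]
  exact mul_le_mul_of_nonneg_left (abs_sub _ _) (abs_nonneg _)

/-- [folklore] The leading term regrouped by lines: `Lead = F z·L4 + Σ_κ Δ_κF z·(L2κ − L3κ) + G z·L1`. -/
theorem lead_eq (Fz Gz : ℝ) (m01 m02 m11 m12 dF dG : Fin 4 → ℝ) (TF TG : Fin 4 → Fin 4 → ℝ) :
    -∑ i, ∑ j, (m01 i * m11 j * (Gz * TF i j) + m01 i * m12 j * (dF i * dG j) + m02 i * m11 j * (dF j * dG i) + m02 i * m12 j * (Fz * TG i j))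
      = Fz * (-∑ i, ∑ j, m02 i * m12 j * TG i j)
        + ∑ κ, dF κ * ((-∑ j, m11 κ * m02 j * dG j) - ∑ j, m12 j * m01 κ * dG j)
        + Gz * (-∑ i, ∑ j, m01 i * m11 j * TF i j) := by
  have e3 : ∑ i, ∑ j, m02 i * m11 j * (dF j * dG i) = ∑ κ, dF κ * ∑ j, m11 κ * m02 j * dG j := by
    rw [Finset.sum_comm]
    refine Finset.sum_congr rfl fun κ _ => ?_
    rw [Finset.mul_sum]
    exact Finset.sum_congr rfl fun j _ => by ring
  have e2 : ∑ i, ∑ j, m01 i * m12 j * (dF i * dG j) = ∑ κ, dF κ * ∑ j, m12 j * m01 κ * dG j := by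
    refine Finset.sum_congr rfl fun κ _ => ?_
    rw [Finset.mul_sum]
    exact Finset.sum_congr rfl fun j _ => by ring
  have e1 : ∑ i, ∑ j, m01 i * m11 j * (Gz * TF i j) = Gz * ∑ i, ∑ j, m01 i * m11 j * TF i j := by
    rw [Finset.mul_sum]
    refine Finset.sum_congr rfl fun i _ => ?_
    rw [Finset.mul_sum]
    exact Finset.sum_congr rfl fun j _ => by ring
  have e4 : ∑ i, ∑ j, m02 i * m12 j * (Fz * TG i j) = Fz * ∑ i, ∑ j, m02 i * m12 j * TG i j := by
    rw [Finset.mul_sum]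
    refine Finset.sum_congr rfl fun i _ => ?_
    rw [Finset.mul_sum]
    exact Finset.sum_congr rfl fun j _ => by ring
  have esplit : ∑ i, ∑ j, (m01 i * m11 j * (Gz * TF i j) + m01 i * m12 j * (dF i * dG j) + m02 i * m11 j * (dF j * dG i) + m02 i * m12 j * (Fz * TG i j))
      = ∑ i, ∑ j, m01 i * m11 j * (Gz * TF i j) + ∑ i, ∑ j, m01 i * m12 j * (dF i * dG j)
        + ∑ i, ∑ j, m02 i * m11 j * (dF j * dG i) + ∑ i, ∑ j, m02 i * m12 j * (Fz * TG i j) := by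
    simp only [Finset.sum_add_distrib]
  have e23 : ∑ κ, dF κ * ((-∑ j, m11 κ * m02 j * dG j) - ∑ j, m12 j * m01 κ * dG j)
      = -(∑ κ, dF κ * ∑ j, m11 κ * m02 j * dG j) - ∑ κ, dF κ * ∑ j, m12 j * m01 κ * dG j := by
    rw [← Finset.sum_neg_distrib, ← Finset.sum_sub_distrib]
    exact Finset.sum_congr rfl fun κ _ => by ring
  rw [esplit, e1, e2, e3, e4, e23]
  ring

/-- [folklore] Four products of inverse powers with total exponent `a+b+3`, collected. -/
theorem collect_le {N A₀ A₁ B₀ e₁ e₂ e₃ e₄ P : ℝ} {a b : ℕ} (hN : 1 ≤ N) (hA0 : 0 ≤ A₀) (hA1 : 0 ≤ A₁) (hB0 : 0 ≤ B₀)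
    {Fz Gz T1 T3 TE : ℝ} {dF T2 : Fin 4 → ℝ}
    (hFz : |Fz| ≤ A₀ / N ^ a) (hdF : ∀ κ, |dF κ| ≤ A₁ / N ^ (a + 1)) (hGz : |Gz| ≤ B₀ / N ^ b)
    (hT1 : T1 ≤ e₁ / N ^ (b + 3)) (hT2 : ∀ κ, T2 κ ≤ e₂ / N ^ (b + 2)) (hTE : TE ≤ P / N ^ (a + 2) * e₄ / N ^ (b + 1)) (hT3 : T3 ≤ e₃ / N ^ (a + 3))
    (hT1n : 0 ≤ T1) (hT2n : ∀ κ, 0 ≤ T2 κ) (hT3n : 0 ≤ T3) :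
    |Fz| * T1 + ∑ κ, |dF κ| * T2 κ + (TE + |Gz| * T3) ≤ (A₀ * e₁ + 4 * A₁ * e₂ + B₀ * e₃ + P * e₄) / N ^ (a + b + 3) := by
  have hN0 : 0 < N := by linarith
  have hp1 : N ^ (a + b + 3) = N ^ a * N ^ (b + 3) := by rw [← pow_add]; congr 1
  have hp2 : N ^ (a + b + 3) = N ^ (a + 1) * N ^ (b + 2) := by rw [← pow_add]; congr 1; ring
  have hp3 : N ^ (a + b + 3) = N ^ b * N ^ (a + 3) := by rw [← pow_add]; congr 1; ring
  have hp4 : N ^ (a + b + 3) = N ^ (a + 2) * N ^ (b + 1) := by rw [← pow_add]; congr 1; ring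
  have t1 : |Fz| * T1 ≤ A₀ * e₁ / N ^ (a + b + 3) := by
    calc |Fz| * T1 ≤ (A₀ / N ^ a) * (e₁ / N ^ (b + 3)) := mul_le_mul hFz hT1 hT1n (by positivity)
      _ = A₀ * e₁ / N ^ (a + b + 3) := by rw [hp1, div_mul_div_comm]
  have t2 : ∑ κ, |dF κ| * T2 κ ≤ 4 * A₁ * e₂ / N ^ (a + b + 3) := by
    have hk : ∀ κ ∈ (Finset.univ : Finset (Fin 4)), |dF κ| * T2 κ ≤ A₁ * e₂ / N ^ (a + b + 3) := by
      intro κ _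
      calc |dF κ| * T2 κ ≤ (A₁ / N ^ (a + 1)) * (e₂ / N ^ (b + 2)) := mul_le_mul (hdF κ) (hT2 κ) (hT2n κ) (by positivity)
        _ = A₁ * e₂ / N ^ (a + b + 3) := by rw [hp2, div_mul_div_comm]
    calc ∑ κ, |dF κ| * T2 κ ≤ ∑ _κ : Fin 4, A₁ * e₂ / N ^ (a + b + 3) := Finset.sum_le_sum hk
      _ = 4 * A₁ * e₂ / N ^ (a + b + 3) := by rw [Finset.sum_const, Finset.card_univ, Fintype.card_fin, nsmul_eq_mul]; ring
  have t3 : |Gz| * T3 ≤ B₀ * e₃ / N ^ (a + b + 3) := by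
    calc |Gz| * T3 ≤ (B₀ / N ^ b) * (e₃ / N ^ (a + 3)) := mul_le_mul hGz hT3 hT3n (by positivity)
      _ = B₀ * e₃ / N ^ (a + b + 3) := by rw [hp3, div_mul_div_comm]
  have t4 : TE ≤ P * e₄ / N ^ (a + b + 3) := by
    calc TE ≤ P / N ^ (a + 2) * e₄ / N ^ (b + 1) := hTE
      _ = P * e₄ / N ^ (a + b + 3) := by rw [hp4]; field_simp
  have e : (A₀ * e₁ + 4 * A₁ * e₂ + B₀ * e₃ + P * e₄) / N ^ (a + b + 3)
      = A₀ * e₁ / N ^ (a + b + 3) + 4 * A₁ * e₂ / N ^ (a + b + 3) + (P * e₄ / N ^ (a + b + 3) + B₀ * e₃ / N ^ (a + b + 3)) := by ring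
  rw [e]
  linarith

/-! ## §2 The assembly -/

section Main

variable {c₀ c₁ : Pt × Pt → ℝ} {F G : Pt → ℝ} {C₀ C₁ δ A₀ A₁ A₂ A₃ B₀ B₁ B₂ B₃ : ℝ} {a b : ℕ}

/-- **H2-ASM-1 — THE DOUBLE SMEAR EXPANDED**: two two-point weights `|c_j(x,x′)| ≤ C_j·e^{−δ(|x|₁+|x′|₁)}` of ZERO TOTAL MASS, legs `F` (letters to third differences,
exponents `a … a+3`) and `G` (`b … b+3`) ⟹ for EVERY `z ∈ ℤ⁴`, `|B z − Lead z| ≤ KR/(‖z‖∞+1)^{a+b+3}` with `B`, `Lead` as in the module docstring and the constant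
`KR = A₀(C₁Zl)(C₀Zl)K₂(G) + 4A₁[(C₁Zm₁)(C₀Zl) + (C₁Zl)(C₀Zm₁)]K₁(G) + B₀(C₁Zl)(C₀Zl)K₂(F) + C₀C₁K₁(F)K₀(G)` written out. [folklore] -/
theorem abs_bubble_sub_lead_le (hδ : 0 < δ)
    (hc₀ : ∀ p : Pt × Pt, |c₀ p| ≤ C₀ * (Real.exp (-δ * l1 p.1) * Real.exp (-δ * l1 p.2)))
    (hc₁ : ∀ p : Pt × Pt, |c₁ p| ≤ C₁ * (Real.exp (-δ * l1 p.1) * Real.exp (-δ * l1 p.2)))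
    (hm₀ : ∑' p : Pt × Pt, c₀ p = 0) (hm₁ : ∑' p : Pt × Pt, c₁ p = 0)
    (hF : ∀ t : Pt, |F t| ≤ A₀ / ((supNorm t : ℝ) + 1) ^ a ∧ (∀ i, |Δ_[(Pi.single i 1 : Pt)] F t| ≤ A₁ / ((supNorm t : ℝ) + 1) ^ (a + 1))
      ∧ (∀ i j, |Δ_[(Pi.single i 1 : Pt)] (Δ_[(Pi.single j 1 : Pt)] F) t| ≤ A₂ / ((supNorm t : ℝ) + 1) ^ (a + 2))
      ∧ (∀ i j l, |Δ_[(Pi.single i 1 : Pt)] (Δ_[(Pi.single j 1 : Pt)] (Δ_[(Pi.single l 1 : Pt)] F)) t| ≤ A₃ / ((supNorm t : ℝ) + 1) ^ (a + 3)))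
    (hG : ∀ t : Pt, |G t| ≤ B₀ / ((supNorm t : ℝ) + 1) ^ b ∧ (∀ i, |Δ_[(Pi.single i 1 : Pt)] G t| ≤ B₁ / ((supNorm t : ℝ) + 1) ^ (b + 1))
      ∧ (∀ i j, |Δ_[(Pi.single i 1 : Pt)] (Δ_[(Pi.single j 1 : Pt)] G) t| ≤ B₂ / ((supNorm t : ℝ) + 1) ^ (b + 2))
      ∧ (∀ i j l, |Δ_[(Pi.single i 1 : Pt)] (Δ_[(Pi.single j 1 : Pt)] (Δ_[(Pi.single l 1 : Pt)] G)) t| ≤ B₃ / ((supNorm t : ℝ) + 1) ^ (b + 3)))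
    (z : Pt) :
    |∑' P : (Pt × Pt) × (Pt × Pt), c₀ P.1 * c₁ P.2 * F (z + P.2.1 - P.1.1) * G (z + P.2.2 - P.1.2)
        - (-∑ i, ∑ j, ((∑' p : Pt × Pt, c₀ p * (p.1 i : ℝ)) * (∑' p : Pt × Pt, c₁ p * (p.1 j : ℝ))
              * (G z * Δ_[(Pi.single i 1 : Pt)] (Δ_[(Pi.single j 1 : Pt)] F) z)
            + (∑' p : Pt × Pt, c₀ p * (p.1 i : ℝ)) * (∑' p : Pt × Pt, c₁ p * (p.2 j : ℝ))
              * (Δ_[(Pi.single i 1 : Pt)] F z * Δ_[(Pi.single j 1 : Pt)] G z)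
            + (∑' p : Pt × Pt, c₀ p * (p.2 i : ℝ)) * (∑' p : Pt × Pt, c₁ p * (p.1 j : ℝ))
              * (Δ_[(Pi.single j 1 : Pt)] F z * Δ_[(Pi.single i 1 : Pt)] G z)
            + (∑' p : Pt × Pt, c₀ p * (p.2 i : ℝ)) * (∑' p : Pt × Pt, c₁ p * (p.2 j : ℝ))
              * (F z * Δ_[(Pi.single i 1 : Pt)] (Δ_[(Pi.single j 1 : Pt)] G) z)))|
      ≤ (A₀ * ((C₁ * Zl 4 δ) * (C₀ * Zl 4 δ) * K₂ δ B₀ B₁ B₂ B₃ b)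
          + 4 * A₁ * ((C₁ * Zm δ 1) * (C₀ * Zl 4 δ) * K₁ δ B₀ B₁ B₂ b + (C₁ * Zl 4 δ) * (C₀ * Zm δ 1) * K₁ δ B₀ B₁ B₂ b)
          + B₀ * ((C₁ * Zl 4 δ) * (C₀ * Zl 4 δ) * K₂ δ A₀ A₁ A₂ A₃ a)
          + (C₀ * C₁ * K₁ δ A₀ A₁ A₂ a) * K₀ δ B₀ B₁ b) / ((supNorm z : ℝ) + 1) ^ (a + b + 3) := by
  have hFA := global_of_decay fun t => (hF t).1
  have hGA := global_of_decay fun t => (hG t).1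
  have hA0 := nonneg_of_decay_pow fun t => (hF t).1
  have hA1 : 0 ≤ A₁ := nonneg_of_decay_pow fun t => (hF t).2.1 0
  have hB0 := nonneg_of_decay_pow fun t => (hG t).1
  -- the marginals (profiles)
  have hu₁ := abs_marginal_snd_le hδ hc₁
  have hu₀ := abs_marginal_snd_le hδ hc₀
  have hν₁ := fun κ y' => abs_marginalMoment_snd_le hδ hc₁ y' κ
  have hν₀ := fun κ x' => abs_marginalMoment_snd_le hδ hc₀ x' κ
  -- (1) the bubble by lines
  rw [tsum_bubble_eq_lines hδ hc₀ hc₁ hFA hGA z]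
  -- (2) the inner smear: remainder weight `E`
  set N : ℝ := (supNorm z : ℝ) + 1 with hN
  have hN1 : 1 ≤ N := by rw [hN]; have := (Nat.cast_nonneg (supNorm z) : (0:ℝ) ≤ _); linarith
  set E : Pt × Pt → ℝ := fun r => ∑' q : Pt × Pt, (c₁ (q.1, r.1) * c₀ (q.2, r.2)) * F (z + q.1 - q.2)
      - (∑' y : Pt, c₁ (y, r.1)) * (∑' x : Pt, c₀ (x, r.2)) * F z
      - ∑ κ, ((∑' y : Pt, (y κ : ℝ) * c₁ (y, r.1)) * (∑' x : Pt, c₀ (x, r.2)) - (∑' y : Pt, c₁ (y, r.1)) * (∑' x : Pt, (x κ : ℝ) * c₀ (x, r.2)))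
          * Δ_[(Pi.single κ 1 : Pt)] F z with hE
  have hEloc : ∀ r : Pt × Pt, |E r| ≤ (C₀ * C₁ * K₁ δ A₀ A₁ A₂ a / N ^ (a + 2)) * (Real.exp (-δ * l1 r.1) * Real.exp (-δ * l1 r.2)) :=
    fun r => abs_inner_sub_le hδ hc₀ hc₁ hF z r
  -- (3) summable pieces and the split of `Σ' S_r G_r`
  have hWs := summable_smear hδ (loc_of_product hu₁ hu₀) hGA z
  have hWas := fun κ => summable_smear hδ (loc_of_product (hν₁ κ) hu₀) hGA z
  have hWbs := fun κ => summable_smear hδ (loc_of_product hu₁ (hν₀ κ)) hGA z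
  have hEs := summable_smear hδ hEloc hGA z
  have HB : HasSum (fun r : Pt × Pt => (∑' q : Pt × Pt, (c₁ (q.1, r.1) * c₀ (q.2, r.2)) * F (z + q.1 - q.2)) * G (z + r.1 - r.2))
      (F z * (∑' r : Pt × Pt, (∑' y : Pt, c₁ (y, r.1)) * (∑' x : Pt, c₀ (x, r.2)) * G (z + r.1 - r.2))
        + ∑ κ, Δ_[(Pi.single κ 1 : Pt)] F z
            * ((∑' r : Pt × Pt, (∑' y : Pt, (y κ : ℝ) * c₁ (y, r.1)) * (∑' x : Pt, c₀ (x, r.2)) * G (z + r.1 - r.2))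
              - ∑' r : Pt × Pt, (∑' y : Pt, c₁ (y, r.1)) * (∑' x : Pt, (x κ : ℝ) * c₀ (x, r.2)) * G (z + r.1 - r.2))
        + ∑' r : Pt × Pt, E r * G (z + r.1 - r.2)) := by
    have H := ((hWs.hasSum.mul_left (F z)).add (hasSum_sum fun κ (_ : κ ∈ (Finset.univ : Finset (Fin 4))) =>
      (((hWas κ).hasSum).sub ((hWbs κ).hasSum)).mul_left (Δ_[(Pi.single κ 1 : Pt)] F z))).add hEs.hasSum
    refine H.congr_fun fun r => ?_
    simp only [hE]
    exact pointwise_split _ _ _ _ _ _ _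
  rw [HB.tsum_eq]
  -- (4) `Σ' E_r G_r = (Σ' E)·G z + O` and `Σ' E = Σ' S`
  have hE0 := abs_smear_sub_order0_le_point' hδ hEloc (fun t => (hG t).1) (fun t => (hG t).2.1) z
  have hSs : Summable fun r : Pt × Pt => ∑' q : Pt × Pt, (c₁ (q.1, r.1) * c₀ (q.2, r.2)) * F (z + q.1 - q.2) := by
    have hloc : ∀ r : Pt × Pt, |∑' q : Pt × Pt, (c₁ (q.1, r.1) * c₀ (q.2, r.2)) * F (z + q.1 - q.2)|
        ≤ (C₁ * C₀ * Θ δ 0 * A₀) * (Real.exp (-δ * l1 r.1) * Real.exp (-δ * l1 r.2)) := fun r => by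
      have h := abs_smear_le hδ (loc_of_product (profile_snd hc₁ r.1) (profile_snd hc₀ r.2)) hFA z
      refine h.trans (le_of_eq ?_); ring
    exact summable_weight hδ hloc
  have hSum_E : ∑' r : Pt × Pt, E r = ∑' r : Pt × Pt, ∑' q : Pt × Pt, (c₁ (q.1, r.1) * c₀ (q.2, r.2)) * F (z + q.1 - q.2) := by
    have hW0 := summable_weight hδ (loc_of_product hu₁ hu₀)
    have hWa0 := fun κ => summable_weight hδ (loc_of_product (hν₁ κ) hu₀)
    have hWb0 := fun κ => summable_weight hδ (loc_of_product hu₁ (hν₀ κ))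
    have s₁ : ∑' y' : Pt, ∑' y : Pt, c₁ (y, y') = 0 := by rw [tsum_marginal_snd hδ hc₁, hm₁]
    have s₀ : ∑' x' : Pt, ∑' x : Pt, c₀ (x, x') = 0 := by rw [tsum_marginal_snd hδ hc₀, hm₀]
    have z1 : ∑' r : Pt × Pt, (∑' y : Pt, c₁ (y, r.1)) * (∑' x : Pt, c₀ (x, r.2)) = 0 := by
      rw [tsum_product_weight hδ hu₁ hu₀, s₁, zero_mul]
    have z2 : ∀ κ, ∑' r : Pt × Pt, (∑' y : Pt, (y κ : ℝ) * c₁ (y, r.1)) * (∑' x : Pt, c₀ (x, r.2)) = 0 := fun κ => by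
      rw [tsum_product_weight hδ (hν₁ κ) hu₀, s₀, mul_zero]
    have z3 : ∀ κ, ∑' r : Pt × Pt, (∑' y : Pt, c₁ (y, r.1)) * (∑' x : Pt, (x κ : ℝ) * c₀ (x, r.2)) = 0 := fun κ => by
      rw [tsum_product_weight hδ hu₁ (hν₀ κ), s₁, zero_mul]
    have hlin : Summable fun r : Pt × Pt => ∑ κ, ((∑' y : Pt, (y κ : ℝ) * c₁ (y, r.1)) * (∑' x : Pt, c₀ (x, r.2))
        - (∑' y : Pt, c₁ (y, r.1)) * (∑' x : Pt, (x κ : ℝ) * c₀ (x, r.2))) * Δ_[(Pi.single κ 1 : Pt)] F z :=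
      summable_sum fun κ _ => ((hWa0 κ).sub (hWb0 κ)).mul_right _
    simp only [hE]
    rw [Summable.tsum_sub (hSs.sub (hW0.mul_right _)) hlin, Summable.tsum_sub hSs (hW0.mul_right _), tsum_mul_right, z1,
      Summable.tsum_finsetSum (fun κ _ => ((hWa0 κ).sub (hWb0 κ)).mul_right _)]
    simp only [tsum_mul_right, Summable.tsum_sub (hWa0 _) (hWb0 _), z2, z3]
    simp
  -- (5) the pieces
  have hT1 := abs_T1_sub_le hδ hc₀ hc₁ hm₀ hm₁ hG z
  have hT2a := fun κ => abs_T2a_sub_le hδ hc₀ hc₁ hm₀ hG z κ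
  have hT2b := fun κ => abs_T2b_sub_le hδ hc₀ hc₁ hm₁ hG z κ
  have hT3 := abs_T3_sub_le hδ hc₀ hc₁ hm₀ hm₁ hF z
  rw [← hSum_E] at hT3
  -- (6) regroup and bound
  rw [lead_eq, assemble_sub (SE := ∑' r : Pt × Pt, E r)]
  refine (abs_assemble_le _ _ _ _ _ _ _ _ _ _ _ _).trans ?_
  have key := collect_le (N := N) (a := a) (b := b) hN1 hA0 hA1 hB0
    (e₁ := (C₁ * Zl 4 δ) * (C₀ * Zl 4 δ) * K₂ δ B₀ B₁ B₂ B₃ b)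
    (e₂ := (C₁ * Zm δ 1) * (C₀ * Zl 4 δ) * K₁ δ B₀ B₁ B₂ b + (C₁ * Zl 4 δ) * (C₀ * Zm δ 1) * K₁ δ B₀ B₁ B₂ b)
    (e₃ := (C₁ * Zl 4 δ) * (C₀ * Zl 4 δ) * K₂ δ A₀ A₁ A₂ A₃ a)
    (e₄ := K₀ δ B₀ B₁ b) (P := C₀ * C₁ * K₁ δ A₀ A₁ A₂ a)
    (hF z).1 (fun κ => (hF z).2.1 κ) (hG z).1 hT1 (fun κ => add_le_add (hT2a κ) (hT2b κ) |>.trans (le_of_eq (by ring))) hE0 hT3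
    (abs_nonneg _) (fun κ => add_nonneg (abs_nonneg _) (abs_nonneg _)) (abs_nonneg _)
  exact key

end Main

end Summit.QuantumFields.BalabanUV.Beta.FP.ExpLocalisedBubbleMixed

end
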